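import Mathlib

/-!
# Schoen étale carrier: the double-point degree in closed form (arithmetic hearts)

W3 (pub-hsemireg widening, special fibres), pen note `W3-DPCLOSED-w3prym1.md`.
For the Schoen carrier `X̃_t ⊂ C̃^{(2d)}` of an étale `μ₃`-cover of a genus-`r` curve
(`d = r - 1`), THEOREM DP (w3-jac-1, `SchoenCarrierDoublePoint.lean`) computes the
double-point degree `δ_r` of the Abel–Prym map by a truncated-ring expansion.  The pen's
closed form is

`δ_r = 3^{d-2} · ( C(2d,d) + 2(-1)^d - 3 · Σ_{m=0}^{d} (-2)^m C(2d, d-m) )`,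

obtained from `∫ c_d(N_u) = 3^{d-1} Σ_{m=0}^{d} (-2)^m C(2d,d-m)` (the sum is the coefficient
`[x^d] (1+x)^{2d}/(1+2x)`) and `[X_t]_P² = 3^{d-2}(C(2d,d) + 2(-1)^d)`.
This file kernel-checks ONLY the arithmetic: the binomial identity
`Σ_i C(m,i) (-3)^{m-i} = (-2)^m` that collapses the expansion, and the values of the two sums
for `d ≤ 8`, which reproduce the three-code table `δ = 0, 2, 0, 54, 270, 3078` (`r = 2..7`),
`∫ c_d(N_u) = 6, 54, 594, 6480, 71928`, and the values `δ = 27216, 272646` (`r = 8, 9`)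
pre-registered by a second seat before the formula existed.  Nothing geometric (Fulton's
double-point formula, Macdonald's Chern class, the restriction lemma) is formalised here;
nothing here bears on HC / HC_CM / HC_AV.  No definitions: every statement is a closed
numerical or polynomial identity, so that the file is proof-only.
-/

namespace Summit.Ventures.HSemireg.SchoenCarrierDeltaClosedForm

open Finset

/-- The collapsing identity behind the closed form:
`[x^m] (1+x)^m / (1+3x) = Σ_i C(m,i) (-3)^{m-i} = (1-3)^m = (-2)^m`. -/
theorem choose_mul_neg_three_pow_sum (m : ℕ) :
    ∑ i ∈ range (m + 1), (m.choose i : ℤ) * (-3) ^ (m - i) = (-2) ^ m := by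
  have h := add_pow (1 : ℤ) (-3) m
  have e : (1 : ℤ) + -3 = -2 := by norm_num
  rw [e] at h
  rw [h]
  refine Finset.sum_congr rfl ?_
  intro i _
  ring

/-- `S(d) := Σ_{m=0}^{d} (-2)^m · C(2d, d-m) = [x^d](1+x)^{2d}/(1+2x)` for `d = 0, …, 8` equals
`1, 0, 2, 6, 22, 80, 296, 1106, 4166`; hence `∫ c_d(N_u) = 3^{d-1}·S(d) = 6, 54, 594, 6480,
71928, 806274, 9111042` for `d = 2, …, 8` (W3-JAC-1-ALB §C2 and the `r = 8, 9` row of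
w3-prym-2's dp_x2). -/
theorem normalChern_sum_values :
    ((List.range 9).map fun d =>
        ∑ m ∈ range (d + 1), (-2 : ℤ) ^ m * ((2 * d).choose (d - m) : ℤ)) =
      [1, 0, 2, 6, 22, 80, 296, 1106, 4166] := by
  decide

/-- `∫ c_d(N_u) = 3^{d-1} · S(d)` for `d = 2, …, 8`: `6, 54, 594, 6480, 71928, 806274, 9111042`. -/
theorem normalChern_values :
    ((List.range 7).map fun i =>
        (3 : ℤ) ^ (i + 1) *
          ∑ m ∈ range (i + 3), (-2 : ℤ) ^ m * ((2 * (i + 2)).choose (i + 2 - m) : ℤ)) =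
      [6, 54, 594, 6480, 71928, 806274, 9111042] := by
  decide

/-- THE TABLE. `δ_r = 3^{d-2}·(C(2d,d) + 2(-1)^d - 3·S(d))` for `d = 2, …, 8` (`r = 3, …, 9`)
equals `2, 0, 54, 270, 3078, 27216, 272646` — the three-code values of W3-JAC-1-ALB §C2 at
`r = 3..7` and the two values pre-registered by w3-prym-2 at `r = 8, 9`. -/
theorem delta_values :
    ((List.range 7).map fun i =>
        (3 : ℤ) ^ i *
          (((2 * (i + 2)).choose (i + 2) : ℤ) + 2 * (-1) ^ (i + 2) -
            3 * ∑ m ∈ range (i + 3), (-2 : ℤ) ^ m * ((2 * (i + 2)).choose (i + 2 - m) : ℤ))) =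
      [2, 0, 54, 270, 3078, 27216, 272646] := by
  decide

/-- At the deciding rung of the (N-3″) door, `r = 5` (`g = 8`, `d = 4`): `δ = 54`
(`= 648 - 594`), i.e. `27` contracted pencils per carrier under the clean-local-structure
proviso `m(d) = 2` of `SchoenCarrierDoublePoint.doublePoint_pencil_contribution`. -/
theorem delta_deciding_rung :
    (3 : ℤ) ^ 2 * (((2 * 4).choose 4 : ℤ) + 2 * (-1) ^ 4 -
        3 * ∑ m ∈ range 5, (-2 : ℤ) ^ m * ((2 * 4).choose (4 - m) : ℤ)) = 54 := by
  decide

/-- The only vanishing in the range `2 ≤ d ≤ 8` is at `d = 3` (`r = 4`, `g = 6`): for every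
other rung `r = 3, 5, 6, 7, 8, 9` the closed form is non-zero, so the Abel–Prym map of the
Schoen carrier is not a closed embedding there (Fulton, Ex. 9.3.1, applied outside this file). -/
theorem delta_core_eq_zero_iff (d : ℕ) (hd : 2 ≤ d) (hd' : d ≤ 8) :
    (((2 * d).choose d : ℤ) + 2 * (-1) ^ d -
        3 * ∑ m ∈ range (d + 1), (-2 : ℤ) ^ m * ((2 * d).choose (d - m) : ℤ)) = 0 ↔ d = 3 := by
  interval_cases d <;> decide

end Summit.Ventures.HSemireg.SchoenCarrierDeltaClosedForm
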